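import Summits.BirchSwinnertonDyer.BirchSwinnertonDyer.Theorems.ResidualThetaTransportAtTwoSignedMuVanishingAtTwoPlusMuUnit
import Summits.BirchSwinnertonDyer.Rank1Residual.Supersingular.BlindInterpolationFlatTwoUnit
import Summits.BirchSwinnertonDyer.Rank1Residual.Supersingular.SprungPollackConsistency
import Summits.BirchSwinnertonDyer.Rank1Residual.Supersingular.KobayashiMainConjecture
import Summits.BirchSwinnertonDyer.Rank1Residual.P2.EmptyCellsAtTwo
import Literature.NumberTheory.EllipticCurves.SkinnerUrban2014.PAdicUnitPeriodRatioAnyPrimeProofs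
import HarnessLib

/-!
# Route `ResidualThetaTransportAtTwo`, crux Kμ⁺ `SignedMuVanishingAtTwoPlus` (stmt-BirchSwinnertonDyer-20689),
# analytic child `SignedMuAnalyticAtTwoPlus` (stmt-21437): the curve-level reduction to `2 ∤ L♭`

Lead line `birth`, seat bsd-wall-rtt-p4 (helper; nothing about any curve is asserted, BSD is not proved
by this). For ONE globally minimal elliptic `W/ℚ` with good reduction at `2` and `a₂(W) = 0`, its
newform `f` (`IsNewformOf W f`), the period ratio `ϖ ∈ ℚ` with `ϖ · Ω_W = Ω⁺_f`, and a Pollack pair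
`(L♯, L♭)` at `2` (`IsPollackPair f 2`, Kobayashi's `L⁺ = kobayashiL 1 L♯ L♭ = L♭`):

* `norm_ratCast_periodRatio_eq_one` — if `Ω_W = u · Ω⁺_f` with `|u|₂ = 1` (the conclusion of the tree
  fact `realPeriodRat_eq_unit_mul_plusPeriod_two`, derived from Abbes–Ullmo Thm. A by
  `SkinnerUrban2014.realPeriodRat_eq_unit_mul_plusPeriod_two_of_abbesUllmo`) then `|ϖ|₂ = 1`;
* `mu_eq_of_isPollackPair_two_of_periodUnit_of_not_two_dvd` — **period unit + `2 ∤ L♭` ⇒ the Kμ⁺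
  analytic bookkeeping** `ι G = 2^m ϖ ι L⁺ ⇒ μ(G) = m` (the `Λ`-algebra `mu_eq_of_map_eq_of_not_C_dvd`);
* `not_two_dvd_iff_mu_eq_of_isPollackPair_two_of_periodUnit` — conversely the bookkeeping for one
  admissible `(G, m)` forces `2 ∤ L♭`: given the period unit, the analytic child AT `W` IS `μ(L♭_f) = 0`;
* `constantCoeff_flat_eq_ratPlusSymbol_zero_of_isPollackPair_two` — at `a₂ = 0` a Pollack pair at `2`
  is a Sprung pair for trace `0` (`isSprungPair_zero_iff`), so `L♭(0) = (−0²+0+1)·[0]⁺_f = [0]⁺_f`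
  (`constantCoeff_flat_two_of_isSprungPair_of_isNewformOf`, Sprung's table at `p = 2`);
* `not_two_dvd_flat_of_norm_ratPlusSymbol_zero_eq_one` — **the per-class CERTIFICATE**: `|[0]⁺_f|₂ = 1`
  ⇒ `2 ∤ L♭`; `…_of_norm_LValue_eq_one` — the same read on `t = L(W,1)/Ω_W` (`= ϖ·[0]⁺_f`): `|t|₂ = 1`
  ⇒ `2 ∤ L♭` given the period unit;
* `mu_eq_of_isPollackPair_two_of_abbesUllmo_of_not_two_dvd` /
  `mu_eq_of_isPollackPair_two_of_abbesUllmo_of_norm_LValue_eq_one` — the same with the period unit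
  DISCHARGED modulo the one print fact `abbesUllmo_not_dvd_maninConstant_of_not_dvd_level`
  (Abbes–Ullmo 1996 Thm. A; `E[2]` irreducible is automatic at good supersingular `2`,
  `P2.irr_two_of_goodSS_two`).
So on the habitat⁺ the analytic child reads: GRANTED Abbes–Ullmo, `μ(L♭_f) = 0` — certified per class
by one odd Néron-normalised plus modular symbol, in particular by an odd `L(W,1)/Ω_W`.
[cite: Pollack2003, Prop. 6.18] [cite: Sprung2017, Cor. 4.4] [cite: AbbesUllmo1996, Thm. A]
-/

set_option autoImplicit false
set_option linter.dupNamespace false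

noncomputable section

open scoped Classical MatrixGroups ModularForm

open CongruenceSubgroup WeierstrassCurve Literature.NumberTheory.EllipticCurves
  Literature.NumberTheory.EllipticCurves.ModularForms Literature.NumberTheory.EllipticCurves.Sprung2017
  Summit.BirchSwinnertonDyer.Rank1Residual.Supersingular Summit.BirchSwinnertonDyer.Rank1Residual.X1

namespace Summit.BirchSwinnertonDyer.BirchSwinnertonDyer.Theorems.SignedMuAtTwo

variable {W : WeierstrassCurve ℚ} [W.IsElliptic] [W.IsGloballyMinimal] {N : ℕ} [NeZero N]
  {f : CuspForm (Gamma0 N) 2}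

/-! ## §1. The period ratio `ϖ` is a `2`-adic unit -/

omit [W.IsGloballyMinimal] [NeZero N] in
/-- If `Ω_W = u · Ω⁺_f` with `|u|₂ = 1` and `ϖ · Ω_W = Ω⁺_f`, then `ϖ = u⁻¹`, so `|ϖ|₂ = 1`
(`Ω_W > 0`, `realPeriodRat_pos`). [cite: GreenbergVatsal2000, §3, Remark 3.4] -/
theorem norm_ratCast_periodRatio_eq_one {ϖ : ℚ} (hϖ : (ϖ : ℝ) * W.realPeriodRat = plusPeriod f)
    (hu : ∃ u : ℚ, ‖(u : ℚ_[2])‖ = 1 ∧ W.realPeriodRat = u * plusPeriod f) :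
    ‖(ϖ : ℚ_[2])‖ = 1 := by
  obtain ⟨u, hu1, hΩ⟩ := hu
  have hΩpos : 0 < W.realPeriodRat := W.realPeriodRat_pos_holds
  have hu0 : u ≠ 0 := by rintro rfl; simp at hu1
  have hϖu : (ϖ : ℝ) * u = 1 := by
    have h1 : (ϖ : ℝ) * (u * plusPeriod f) = plusPeriod f := by rw [← hΩ]; exact hϖ
    have hf0 : plusPeriod f ≠ 0 := by
      intro h0; rw [h0, mul_zero] at hΩ; exact hΩpos.ne' hΩ
    have h2 : ((ϖ : ℝ) * u - 1) * plusPeriod f = 0 := by rw [sub_mul, one_mul, mul_assoc, h1, sub_self]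
    exact sub_eq_zero.mp ((mul_eq_zero.mp h2).resolve_right hf0)
  have hϖu' : ϖ * u = 1 := by exact_mod_cast hϖu
  have hϖeq : ϖ = u⁻¹ := eq_inv_of_mul_eq_one_left hϖu'
  rw [hϖeq, Rat.cast_inv, norm_inv, hu1, inv_one]

/-- **The period unit at `2` from Abbes–Ullmo** on the habitat: for `W` good supersingular at `2`
(`E[2]` is then irreducible, `P2.irr_two_of_goodSS_two`) and `f` its newform, granted the print fact
`abbesUllmo_not_dvd_maninConstant_of_not_dvd_level` there is `u ∈ ℚ`, `|u|₂ = 1`, `Ω_W = u · Ω⁺_f`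
(`SkinnerUrban2014.realPeriodRat_eq_unit_mul_plusPeriod_two_of_abbesUllmo`). [cite: AbbesUllmo1996, Thm. A] -/
theorem exists_periodUnit_two_of_abbesUllmo (hAU : abbesUllmo_not_dvd_maninConstant_of_not_dvd_level)
    (hss : Rank1Residual.GoodSS W 2) (hf : IsNewformOf W f) :
    ∃ u : ℚ, ‖(u : ℚ_[2])‖ = 1 ∧ W.realPeriodRat = u * plusPeriod f :=
  SkinnerUrban2014.realPeriodRat_eq_unit_mul_plusPeriod_two_of_abbesUllmo hAU W hss.1
    (Rank1Residual.P2.irr_two_of_goodSS_two W hss) f hf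

/-! ## §2. Period unit + `2 ∤ L♭` ⇔ the analytic bookkeeping at `W` -/

omit [W.IsGloballyMinimal] [NeZero N] in
/-- **Period unit + `2 ∤ L♭` ⇒ `μ(G) = m`** whenever `ι G = 2^m ϖ · ι L⁺_W`, `L⁺_W = kobayashiL 1 L♯ L♭`
(`= L♭`): the analytic conjunct of Kμ⁺ at `W`. [cite: Pollack2003, Prop. 6.18] -/
theorem mu_eq_of_isPollackPair_two_of_periodUnit_of_not_two_dvd {ϖ : ℚ}
    (hϖ : (ϖ : ℝ) * W.realPeriodRat = plusPeriod f)
    (hu : ∃ u : ℚ, ‖(u : ℚ_[2])‖ = 1 ∧ W.realPeriodRat = u * plusPeriod f)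
    {Lplus Lminus : IwasawaAlgebra 2} (hμ : ¬ PowerSeries.C (2 : ℤ_[2]) ∣ Lminus)
    (G : IwasawaAlgebra 2) (m : ℕ)
    (hG : iwasawaToPowerSeries 2 G =
      PowerSeries.C ((2 : ℚ_[2]) ^ m * (ϖ : ℚ_[2])) * iwasawaToPowerSeries 2 (kobayashiL 1 Lplus Lminus)) :
    MuLambda.mu G = m := by
  have hk : kobayashiL (p := 2) 1 Lplus Lminus = Lminus := by unfold kobayashiL; rw [if_pos rfl]
  rw [hk] at hG
  have h2 : ((2 : ℕ) : ℚ_[2]) = 2 := by norm_num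
  exact mu_eq_of_map_eq_of_not_C_dvd (p := 2) (norm_ratCast_periodRatio_eq_one hϖ hu) hμ
    (by rw [h2]; exact hG)

omit [W.IsGloballyMinimal] [NeZero N] in
/-- **Conversely**: given the period unit and a Pollack pair (`L♭ ≠ 0`), the bookkeeping `μ(G) = m`
for ONE admissible `(G, m)` forces `2 ∤ L♭`; so the analytic child at `W` is exactly `μ(L♭_f) = 0`.
[cite: Pollack2003, Prop. 6.18] -/
theorem not_two_dvd_iff_mu_eq_of_isPollackPair_two_of_periodUnit {ϖ : ℚ}
    (hϖ : (ϖ : ℝ) * W.realPeriodRat = plusPeriod f)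
    (hu : ∃ u : ℚ, ‖(u : ℚ_[2])‖ = 1 ∧ W.realPeriodRat = u * plusPeriod f)
    {Lplus Lminus : IwasawaAlgebra 2} (hP : IsPollackPair f 2 Lplus Lminus)
    (G : IwasawaAlgebra 2) (m : ℕ)
    (hG : iwasawaToPowerSeries 2 G =
      PowerSeries.C ((2 : ℚ_[2]) ^ m * (ϖ : ℚ_[2])) * iwasawaToPowerSeries 2 (kobayashiL 1 Lplus Lminus)) :
    ¬ PowerSeries.C (2 : ℤ_[2]) ∣ Lminus ↔ MuLambda.mu G = m := by
  have hk : kobayashiL (p := 2) 1 Lplus Lminus = Lminus := by unfold kobayashiL; rw [if_pos rfl]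
  rw [hk] at hG
  have h2 : ((2 : ℕ) : ℚ_[2]) = 2 := by norm_num
  exact (mu_eq_iff_not_C_dvd_of_map_eq (p := 2) (norm_ratCast_periodRatio_eq_one hϖ hu) hP.2.1
    (by rw [h2]; exact hG)).symm

/-! ## §3. The certificate: `L♭(0) = [0]⁺_f`, so an odd `[0]⁺_f` (or odd `L(W,1)/Ω_W`) gives `2 ∤ L♭` -/

/-- **`L♭(0) = [0]⁺_f` at `p = 2`, `a₂ = 0`**: a Pollack pair at `2` is a Sprung pair for trace `0`
(`isSprungPair_zero_iff`), and Sprung's `♭` constant at `2` is `(−a₂² + 2a₂ + 1)·[0]⁺_f = [0]⁺_f`.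
[cite: Sprung2017, Cor. 4.4 and Cor. 4.11] [cite: Pollack2003, Prop. 6.18] -/
theorem constantCoeff_flat_eq_ratPlusSymbol_zero_of_isPollackPair_two (hf : IsNewformOf W f)
    (hgood : W.HasGoodReductionAtPrime 2) (ha : W.frobeniusTrace 2 = 0)
    {Lplus Lminus : IwasawaAlgebra 2} (hP : IsPollackPair f 2 Lplus Lminus) :
    ((PowerSeries.constantCoeff Lminus : ℤ_[2]) : ℚ_[2]) = ((ratPlusSymbol f 0 : ℚ) : ℚ_[2]) := by
  have hSP : IsSprungPair f 2 (W.frobeniusTrace 2) Lplus Lminus := by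
    rw [ha]; exact (isSprungPair_zero_iff f 2 Lplus Lminus).mpr ⟨hP.2.2.1, hP.2.2.2⟩
  rw [constantCoeff_flat_two_of_isSprungPair_of_isNewformOf hf hgood hSP, ha]
  push_cast; ring

/-- **Certificate `[0]⁺_f` odd ⇒ `2 ∤ L♭`** (unit constant term). [cite: Sprung2017, Cor. 4.4] -/
theorem not_two_dvd_flat_of_norm_ratPlusSymbol_zero_eq_one (hf : IsNewformOf W f)
    (hgood : W.HasGoodReductionAtPrime 2) (ha : W.frobeniusTrace 2 = 0)
    {Lplus Lminus : IwasawaAlgebra 2} (hP : IsPollackPair f 2 Lplus Lminus)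
    (h0 : ‖((ratPlusSymbol f 0 : ℚ) : ℚ_[2])‖ = 1) :
    ¬ PowerSeries.C (2 : ℤ_[2]) ∣ Lminus := by
  have h := not_C_dvd_of_norm_constantCoeff_eq_one (p := 2) (L := Lminus)
    (by rw [constantCoeff_flat_eq_ratPlusSymbol_zero_of_isPollackPair_two hf hgood ha hP]; exact h0)
  simpa using h

/-- **Certificate on the `L`-value**: with the period unit, `L(W,1)/Ω_W = t = ϖ·[0]⁺_f`, so
`|t|₂ = 1 ⇒ 2 ∤ L♭`. (`t` is the BSD quotient `#Ш·∏c_ℓ/#E(ℚ)_tors²` predicted for `W`; on the habitat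
the torsion is odd, so this certificate is "analytic Ш·Tam of `W` is odd".)
[cite: Sprung2017, Cor. 4.4] [cite: MazurTateTeitelbaum1986Invent, §I.8 (8.6)] -/
theorem not_two_dvd_flat_of_norm_LValue_eq_one (hf : IsNewformOf W f)
    (hgood : W.HasGoodReductionAtPrime 2) (ha : W.frobeniusTrace 2 = 0) {ϖ : ℚ}
    (hϖ : (ϖ : ℝ) * W.realPeriodRat = plusPeriod f)
    (hu : ∃ u : ℚ, ‖(u : ℚ_[2])‖ = 1 ∧ W.realPeriodRat = u * plusPeriod f)
    {Lplus Lminus : IwasawaAlgebra 2} (hP : IsPollackPair f 2 Lplus Lminus)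
    {t : ℚ} (ht : W.entireLFunction 1 / (W.realPeriodRat : ℂ) = (t : ℂ)) (ht1 : ‖(t : ℚ_[2])‖ = 1) :
    ¬ PowerSeries.C (2 : ℤ_[2]) ∣ Lminus := by
  have hΩpos : 0 < W.realPeriodRat := W.realPeriodRat_pos_holds
  -- `t = ϖ · [0]⁺_f`
  have hts : t = ϖ * ratPlusSymbol f 0 := by
    have h1 : W.entireLFunction 1 = ((t : ℝ) : ℂ) * (W.realPeriodRat : ℂ) := by
      rw [← div_eq_iff (Complex.ofReal_ne_zero.mpr hΩpos.ne')] ; exact_mod_cast ht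
    rw [hf.entireLFunction_one_eq, ← hϖ] at h1
    have h2 : ((ratPlusSymbol f 0 : ℚ) : ℝ) * ((ϖ : ℝ) * W.realPeriodRat) = (t : ℝ) * W.realPeriodRat := by
      exact_mod_cast h1
    have h3 : (((ratPlusSymbol f 0 : ℚ) : ℝ) * (ϖ : ℝ) - t) * W.realPeriodRat = 0 := by
      rw [sub_mul, mul_assoc, h2, sub_self]
    have h4 := sub_eq_zero.mp ((mul_eq_zero.mp h3).resolve_right hΩpos.ne')
    have h5 : ratPlusSymbol f 0 * ϖ = t := by exact_mod_cast h4
    rw [← h5, mul_comm]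
  refine not_two_dvd_flat_of_norm_ratPlusSymbol_zero_eq_one hf hgood ha hP ?_
  have hϖ1 := norm_ratCast_periodRatio_eq_one hϖ hu
  have : ‖((t : ℚ) : ℚ_[2])‖ = ‖(ϖ : ℚ_[2])‖ * ‖((ratPlusSymbol f 0 : ℚ) : ℚ_[2])‖ := by
    rw [hts, Rat.cast_mul, norm_mul]
  rw [ht1, hϖ1, one_mul] at this
  exact this.symm

/-! ## §4. The same modulo the one print fact (Abbes–Ullmo Thm. A) -/

/-- **GRANTED Abbes–Ullmo: `2 ∤ L♭ ⇒` the analytic conjunct of Kμ⁺ at `W`** (good supersingular at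
`2`, `a₂ = 0`). [cite: AbbesUllmo1996, Thm. A] [cite: Pollack2003, Prop. 6.18] -/
theorem mu_eq_of_isPollackPair_two_of_abbesUllmo_of_not_two_dvd
    (hAU : abbesUllmo_not_dvd_maninConstant_of_not_dvd_level)
    (hss : Rank1Residual.GoodSS W 2) (hf : IsNewformOf W f) {ϖ : ℚ}
    (hϖ : (ϖ : ℝ) * W.realPeriodRat = plusPeriod f)
    {Lplus Lminus : IwasawaAlgebra 2} (hμ : ¬ PowerSeries.C (2 : ℤ_[2]) ∣ Lminus)
    (G : IwasawaAlgebra 2) (m : ℕ)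
    (hG : iwasawaToPowerSeries 2 G =
      PowerSeries.C ((2 : ℚ_[2]) ^ m * (ϖ : ℚ_[2])) * iwasawaToPowerSeries 2 (kobayashiL 1 Lplus Lminus)) :
    MuLambda.mu G = m :=
  mu_eq_of_isPollackPair_two_of_periodUnit_of_not_two_dvd hϖ
    (exists_periodUnit_two_of_abbesUllmo hAU hss hf) hμ G m hG

/-- **GRANTED Abbes–Ullmo: an odd `L(W,1)/Ω_W` certifies the analytic conjunct of Kμ⁺ at `W`.**
[cite: AbbesUllmo1996, Thm. A] [cite: Sprung2017, Cor. 4.4] -/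
theorem mu_eq_of_isPollackPair_two_of_abbesUllmo_of_norm_LValue_eq_one
    (hAU : abbesUllmo_not_dvd_maninConstant_of_not_dvd_level)
    (hss : Rank1Residual.GoodSS W 2) (ha : W.frobeniusTrace 2 = 0) (hf : IsNewformOf W f) {ϖ : ℚ}
    (hϖ : (ϖ : ℝ) * W.realPeriodRat = plusPeriod f)
    {Lplus Lminus : IwasawaAlgebra 2} (hP : IsPollackPair f 2 Lplus Lminus)
    {t : ℚ} (ht : W.entireLFunction 1 / (W.realPeriodRat : ℂ) = (t : ℂ)) (ht1 : ‖(t : ℚ_[2])‖ = 1)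
    (G : IwasawaAlgebra 2) (m : ℕ)
    (hG : iwasawaToPowerSeries 2 G =
      PowerSeries.C ((2 : ℚ_[2]) ^ m * (ϖ : ℚ_[2])) * iwasawaToPowerSeries 2 (kobayashiL 1 Lplus Lminus)) :
    MuLambda.mu G = m :=
  have hu := exists_periodUnit_two_of_abbesUllmo hAU hss hf
  mu_eq_of_isPollackPair_two_of_periodUnit_of_not_two_dvd hϖ hu
    (not_two_dvd_flat_of_norm_LValue_eq_one hf hss.1 ha hϖ hu hP ht ht1) G m hG

end Summit.BirchSwinnertonDyer.BirchSwinnertonDyer.Theorems.SignedMuAtTwo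

end
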